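import Summits.QuantumFields.BalabanUV.Beta.GAN24.ExitFaceCurrentTowerStep
import Summits.QuantumFields.BalabanUV.Beta.GAN24.ExitFaceCurrentSectorSplit
import Summits.QuantumFields.BalabanUV.Beta.GAN24.LambdaSectorClassSlot
import Summits.QuantumFields.BalabanUV.Beta.GAN24.LambdaSectorClassSlotZero
import Summits.QuantumFields.BalabanUV.Beta.SpineRecursiveParity
import Summits.QuantumFields.BalabanUV.Beta.GAN24.WilsonCurrentBoxForm
import Summits.QuantumFields.BalabanUV.Beta.GAN24.ExitFaceCurrentCellTotals
import Summits.QuantumFields.BalabanUV.Beta.GAN24.FaceDatumMultiplierResponse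

/-!
# `BalabanUV.Beta.GAN24.ExitFaceCurrentDivFree` — binder row G-an2-4 ∕ (CONV-C), W-slot CT-W, conservation law (C)∕(C)sym AT ALL LEVELS, THE CONSUMER BRIDGE (R3, second half) of this
# lineage's note `HOME/b2b-balaban-gan24-formalise-leaf-04/g68/EXIT-FACE-CURRENT-TOWER.md` §8: **(D)_{j+1} — THE BOND-RESUMMED EXIT-FACE CURRENT OF THE LEVEL-`(j+1)` VALUE-FUNCTION CUBIC
# SECTOR IS DIVERGENCE-FREE, FOR EVERY `j`, EVERY IN-BLOCK ROOT, ALL UNITS `sf sm`, ALL SECTOR CONSTANTS `cE cVH cΛ` AND EVERY SCALAR `C₀` ON THE CUBIC TABLE** — literally the hypothesis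
# `(hdiv)` of E `ExitFaceCurrentCellTotalsStep.tsum_noFF_left_E_right_word_eq_zero_succ_of_divFree` (there `C₀ = Lc^{d+1}·wE_{j+1}`, `cE = Lc^{d+1}`, `cVH = −Lc^{d+1}·½·Lc^{d+1}`): the pair
# current through the dressed half vertex is `A·Σ'_w 𝟙f(w_β)·Σ'_t 𝟙f(t_ν)·S̃ ν t p w` (D `ExitFaceCurrentCellTotals.tsum_weight_current_eq_faceSlot`), the units and the scalar are constants on
# ff entries, the face indicator is the class datum `Lc⁻¹ + d(−Lc⁻¹·(· mod Lc))`, and the tower `ExitFaceCurrentTower.divFree_e3OfK_SrecAt` concludes.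

ONE MODULE, TWO PARTS (leaf-04 gen 70, 2026-08-23): Part A = gen 68's staged module `ExitFaceCurrentTower` (THE (D)-TOWER, namespace `…GAN24.ExitFaceCurrentTower`: `divFree_SrecAt_succ_of_divFree`,
`divFree_S0NAt_of_wilson`, `divFree_SrecAt_all_of_wilson`, `divFree_e3OfK_SrecAt_of_wilson`, `divFree_SrecAt_all`, `divFree_e3OfK_SrecAt`; never filed as a separate module) and Part B =
gen 68's staged consumer bridge (namespace `…GAN24.ExitFaceCurrentDivFree`), each a complete `noncomputable section`, bytes of both bodies UNCHANGED from the twins certified together by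
gen 68's concat certs (rc 0, 0 sorry); merged only to shorten the gate's olean chain.

NOT IN PRINT; OUR BOOKKEEPING ([folklore] composition BY NAME; G-an2-4 formalisation swarm, leaf prover `b2b-balaban-gan24-formalise-leaf-04`, gen 68).  HONEST FRAMING (cell contract,
verbatim): «discharging `BetaPertH` makes Bałaban's UV stability UNCONDITIONAL — a real constructive-QFT result; it is NOT the continuum limit and NOT the Clay problem.»  HONEST DEPENDENCY
(verbatim): «continuum YM on T⁴ ⇐ BetaPertH ∧ nine spine estimates (0/9 proved); BetaPertH ⇐ (D1) ∧ (D4) ∧ CAP+tail; G-an2-4 gates asym, D1 and NE2/3/4.»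

WHAT ([folklore]; generic `d`, `[NeZero Lc]`, in-block root; 0 `def`, 0 cited facts, 0 `def … : Prop`, 0 sorry): `face_eq_class` (the face indicator as a class datum), `unitS_smul_inl_inl`
(units × scalar on an ff entry), **`exitFace_pairCurrent_divFree`** — E's `(hdiv)` for all `sf sm cE cVH cΛ C₀ j ν β p`.  Asserts NO value of Bałaban's tables; discharges NOTHING of (C)sym ∕
(Q-D) ∕ (Q-D-rate) ∕ «T2Shape» ∕ «T2Drift» ∕ (hW, hWall); NEVER «G-an2-4 closed» as (CONV-C); NOT D1, NOT `BetaPertH`, NOT continuum, NOT Clay.  2026-08-23; no existing file touched.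
-/

/-!
# Part A — namespace `…GAN24.ExitFaceCurrentTower`: THE (D)-TOWER (R3, first half of the note's §7)

# (gen 68's staged module name `GAN24.ExitFaceCurrentTower`; here Part A) — binder row G-an2-4 ∕ (CONV-C), W-slot CT-W, conservation law (C)∕(C)sym AT ALL LEVELS, the ASSEMBLY (R3, first half) of this lineage's
# note `HOME/b2b-balaban-gan24-formalise-leaf-04/g68/EXIT-FACE-CURRENT-TOWER.md` §7: **THE (D)-TOWER — IF THE CLASS-WEIGHTED TWO-LEG CURRENTS OF an3's BARE WILSON CUBIC TABLE ARE
# FIRST-LEG DIVERGENCE-FREE, THEN SO ARE THOSE OF EVERY MEMBER `SrecAt j` OF THE RECURSIVE SPINE AND OF ITS CUBIC SECTOR `e3OfK Lc G_j (SrecAt j)`, EVERY `j`** — induction over the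
# sector split (`ExitFaceCurrentSectorSplit`), the E-step (`ExitFaceCurrentTowerStep`), the Λ kills (`LambdaSectorClassSlot{,Zero}`), the locality and parity of the members
# (`WardLocusRecursive.locStencil_SrecAt`, `SpineRecursiveParity.trK_SrecAt`), and the base T0 in `tsum` form (`WilsonCurrentBoxForm.divFree_wilson_current`) — so the tower is
# UNCONDITIONAL: **every class-weighted two-leg current of `e3OfK Lc G_j (SrecAt j)` is first-leg divergence-free, every `j`, every in-block root, all `cE cVH cΛ`.**

NOT IN PRINT; OUR BOOKKEEPING ([folklore] composition BY NAME; G-an2-4 formalisation swarm, leaf prover `b2b-balaban-gan24-formalise-leaf-04`, gen 68).  HONEST FRAMING (cell contract,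
verbatim): «discharging `BetaPertH` makes Bałaban's UV stability UNCONDITIONAL — a real constructive-QFT result; it is NOT the continuum limit and NOT the Clay problem.»  HONEST DEPENDENCY
(verbatim): «continuum YM on T⁴ ⇐ BetaPertH ∧ nine spine estimates (0/9 proved); BetaPertH ⇐ (D1) ∧ (D4) ∧ CAP+tail; G-an2-4 gates asym, D1 and NE2/3/4.»

WHAT ([folklore]; generic `d`, `[NeZero Lc]`, in-block root `r ∈ box Lc`, all `cE cVH cΛ`; 0 `def`, 0 cited facts, 0 `def … : Prop`, 0 sorry): **`divFree_SrecAt_succ_of_divFree`** (member `j` ⇒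
member `j+1`), **`divFree_S0NAt_of_wilson`** (bare Wilson ⇒ member `0`), **`divFree_SrecAt_all_of_wilson`** (bare Wilson ⇒ every member), **`divFree_e3OfK_SrecAt_of_wilson`** (bare Wilson ⇒
the cubic sector of every member), and UNCONDITIONALLY (T0 via `WilsonCurrentBoxForm`) **`divFree_SrecAt_all`**, **`divFree_e3OfK_SrecAt`** — the shape E's `(hdiv)` consumes, up to the
`unitS`∕`cE·wE` bridge.  Asserts NO value of Bałaban's tables; discharges NOTHING of (C)sym ∕ (Q-D) ∕ (Q-D-rate) ∕
«T2Shape» ∕ «T2Drift» ∕ (hW, hWall); NEVER «G-an2-4 closed» as (CONV-C); NOT D1, NOT `BetaPertH`, NOT continuum, NOT Clay.  2026-08-23; no existing file touched.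
-/

noncomputable section

open Finset
open scoped BigOperators
open Literature.MathematicalPhysics.QuantumFieldTheory
open Literature.MathematicalPhysics.QuantumFieldTheory.Balaban1983to89
open Literature.MathematicalPhysics.QuantumFieldTheory.Balaban1983to89.Beta
open ExpKernelCalculus (Site MKer)
open AffineAveraging (box toSite)
open B6BondElimination (unitVec)
open OneStepResolventKernel (Fib KInv)
open OneStepKernelFamily (KInvStep)
open AveragingHessianKernelsRooted (hessFFAt)
open InterLevelTransport (SLam)
open BalabanStepJets (lamCoeffOf)
open BalabanStepJetsSucc (E2 lamCoeffK wE wΛ)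
open StepJetData (wilsonA)
open Summit.QuantumFields.BalabanUV.Beta.TameKernelCalculus (trK)
open Summit.QuantumFields.BalabanUV.Beta.BorderedHessian (sgnK)
open Summit.QuantumFields.BalabanUV.Beta.AxialDressingRooted (coDressKBmAt)
open Summit.QuantumFields.BalabanUV.Beta.SpineRooted (S0NAt e3OfK)
open Summit.QuantumFields.BalabanUV.Beta.WardLocusRecursive (SrecAt SrecAt_zero locStencil_SrecAt)
open Summit.QuantumFields.BalabanUV.Beta.SpineRecursiveParity (trK_SrecAt)
open Summit.QuantumFields.BalabanUV.Beta.GAN24.ExitFaceCurrentTowerStep (divFree_e3OfK_of_divFree)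
open Summit.QuantumFields.BalabanUV.Beta.GAN24.ExitFaceCurrentSectorSplit (divFree_current_SrecAt_succ_of_sectors divFree_current_S0NAt_of_sectors)
open Summit.QuantumFields.BalabanUV.Beta.GAN24.LambdaSectorClassSlot (divFree_lamSector_current)
open Summit.QuantumFields.BalabanUV.Beta.GAN24.LambdaSectorClassSlotZero (divFree_lamSectorZero_current)
open Summit.QuantumFields.BalabanUV.Beta.GAN24.WilsonCurrentBoxForm (divFree_wilson_current)

namespace Summit.QuantumFields.BalabanUV.Beta.GAN24.ExitFaceCurrentTower

variable {d : ℕ} {Lc : ℕ} [NeZero Lc] {r : Fin (d + 1) → ℕ}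

/-- [folklore] **THE INDUCTION STEP ON THE SPINE**: class-weighted first-leg divergence-freeness passes from member `j` to member `j+1` (sector split; E by `divFree_e3OfK_of_divFree` with the
member's locality and parity; Λ by `divFree_lamSector_current`; VH absent). -/
theorem divFree_SrecAt_succ_of_divFree (hr : r ∈ box (d + 1) Lc) (cE cVH cΛ : ℝ) (j : ℕ)
    (hyp : ∀ (ν β : Fin (d + 1)) (c₁ : ℝ) (Ψ₁ : ℤ → ℝ) (B₁ : ℝ), (∀ s, |Ψ₁ s| ≤ B₁) → ∀ (c₂ : ℝ) (Ψ₂ : ℤ → ℝ) (B₂ : ℝ), (∀ s, |Ψ₂ s| ≤ B₂) → ∀ v : Site (d + 1),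
      ∑ κ' : Fin (d + 1),
        ((∑' q : Site (d + 1), (c₁ + (Ψ₁ (q β + 1) - Ψ₁ (q β))) * ∑' u : Site (d + 1), (c₂ + (Ψ₂ (u ν + 1) - Ψ₂ (u ν))) *
            SrecAt d Lc (toSite r) cE cVH cΛ j ν u v q (Sum.inl κ') (Sum.inl β))
          - ∑' q : Site (d + 1), (c₁ + (Ψ₁ (q β + 1) - Ψ₁ (q β))) * ∑' u : Site (d + 1), (c₂ + (Ψ₂ (u ν + 1) - Ψ₂ (u ν))) *
            SrecAt d Lc (toSite r) cE cVH cΛ j ν u (v - unitVec κ') q (Sum.inl κ') (Sum.inl β)) = 0) :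
    ∀ (ν β : Fin (d + 1)) (c₁ : ℝ) (Ψ₁ : ℤ → ℝ) (B₁ : ℝ), (∀ s, |Ψ₁ s| ≤ B₁) → ∀ (c₂ : ℝ) (Ψ₂ : ℤ → ℝ) (B₂ : ℝ), (∀ s, |Ψ₂ s| ≤ B₂) → ∀ v : Site (d + 1),
      ∑ κ' : Fin (d + 1),
        ((∑' q : Site (d + 1), (c₁ + (Ψ₁ (q β + 1) - Ψ₁ (q β))) * ∑' u : Site (d + 1), (c₂ + (Ψ₂ (u ν + 1) - Ψ₂ (u ν))) *
            SrecAt d Lc (toSite r) cE cVH cΛ (j + 1) ν u v q (Sum.inl κ') (Sum.inl β))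
          - ∑' q : Site (d + 1), (c₁ + (Ψ₁ (q β + 1) - Ψ₁ (q β))) * ∑' u : Site (d + 1), (c₂ + (Ψ₂ (u ν + 1) - Ψ₂ (u ν))) *
            SrecAt d Lc (toSite r) cE cVH cΛ (j + 1) ν u (v - unitVec κ') q (Sum.inl κ') (Sum.inl β)) = 0 := by
  intro ν β c₁ Ψ₁ B₁ hΨ₁ c₂ Ψ₂ B₂ hΨ₂ v
  have hLc : 1 ≤ Lc := Nat.one_le_iff_ne_zero.mpr (NeZero.ne Lc)
  obtain ⟨Cs, δs, hδs, hS⟩ := locStencil_SrecAt hLc hr cE cVH cΛ j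
  have hpar := trK_SrecAt (d := d) hLc hr cE cVH cΛ j
  have hh : ∀ q : Site (d + 1), |c₁ + (Ψ₁ (q β + 1) - Ψ₁ (q β))| ≤ |c₁| + (B₁ + B₁) := fun q =>
    (abs_add_le _ _).trans (add_le_add le_rfl ((abs_sub _ _).trans (add_le_add (hΨ₁ _) (hΨ₁ _))))
  have hs : ∀ u : Site (d + 1), |c₂ + (Ψ₂ (u ν + 1) - Ψ₂ (u ν))| ≤ |c₂| + (B₂ + B₂) := fun u =>
    (abs_add_le _ _).trans (add_le_add le_rfl ((abs_sub _ _).trans (add_le_add (hΨ₂ _) (hΨ₂ _))))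
  refine divFree_current_SrecAt_succ_of_sectors hr cE cVH cΛ j ν β hh hs v ?_ ?_
  · exact divFree_e3OfK_of_divFree hr j hS hδs hpar ν β (hyp ν β) c₁ Ψ₁ hΨ₁ c₂ Ψ₂ hΨ₂ v
  · exact divFree_lamSector_current hr j ν β c₂ Ψ₂ hΨ₂ _ v

/-- [folklore] **THE BASE ON THE SPINE**: member `0` (`S0NAt`) from an3's bare Wilson cubic table (sector split; Λ₀ by `divFree_lamSectorZero_current`; VH absent). -/
theorem divFree_S0NAt_of_wilson (hr : r ∈ box (d + 1) Lc) (cE cVH cΛ : ℝ)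
    (hW : ∀ (ν β : Fin (d + 1)) (c₁ : ℝ) (Ψ₁ : ℤ → ℝ) (B₁ : ℝ), (∀ s, |Ψ₁ s| ≤ B₁) → ∀ (c₂ : ℝ) (Ψ₂ : ℤ → ℝ) (B₂ : ℝ), (∀ s, |Ψ₂ s| ≤ B₂) → ∀ v : Site (d + 1),
      ∑ κ' : Fin (d + 1),
        ((∑' q : Site (d + 1), (c₁ + (Ψ₁ (q β + 1) - Ψ₁ (q β))) * ∑' u : Site (d + 1), (c₂ + (Ψ₂ (u ν + 1) - Ψ₂ (u ν))) * wilsonA d ν u v q (Sum.inl κ') (Sum.inl β))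
          - ∑' q : Site (d + 1), (c₁ + (Ψ₁ (q β + 1) - Ψ₁ (q β))) * ∑' u : Site (d + 1), (c₂ + (Ψ₂ (u ν + 1) - Ψ₂ (u ν))) * wilsonA d ν u (v - unitVec κ') q (Sum.inl κ') (Sum.inl β)) = 0) :
    ∀ (ν β : Fin (d + 1)) (c₁ : ℝ) (Ψ₁ : ℤ → ℝ) (B₁ : ℝ), (∀ s, |Ψ₁ s| ≤ B₁) → ∀ (c₂ : ℝ) (Ψ₂ : ℤ → ℝ) (B₂ : ℝ), (∀ s, |Ψ₂ s| ≤ B₂) → ∀ v : Site (d + 1),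
      ∑ κ' : Fin (d + 1),
        ((∑' q : Site (d + 1), (c₁ + (Ψ₁ (q β + 1) - Ψ₁ (q β))) * ∑' u : Site (d + 1), (c₂ + (Ψ₂ (u ν + 1) - Ψ₂ (u ν))) *
            S0NAt d Lc (toSite r) cE cVH cΛ ν u v q (Sum.inl κ') (Sum.inl β))
          - ∑' q : Site (d + 1), (c₁ + (Ψ₁ (q β + 1) - Ψ₁ (q β))) * ∑' u : Site (d + 1), (c₂ + (Ψ₂ (u ν + 1) - Ψ₂ (u ν))) *
            S0NAt d Lc (toSite r) cE cVH cΛ ν u (v - unitVec κ') q (Sum.inl κ') (Sum.inl β)) = 0 := by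
  intro ν β c₁ Ψ₁ B₁ hΨ₁ c₂ Ψ₂ B₂ hΨ₂ v
  have hh : ∀ q : Site (d + 1), |c₁ + (Ψ₁ (q β + 1) - Ψ₁ (q β))| ≤ |c₁| + (B₁ + B₁) := fun q =>
    (abs_add_le _ _).trans (add_le_add le_rfl ((abs_sub _ _).trans (add_le_add (hΨ₁ _) (hΨ₁ _))))
  have hs : ∀ u : Site (d + 1), |c₂ + (Ψ₂ (u ν + 1) - Ψ₂ (u ν))| ≤ |c₂| + (B₂ + B₂) := fun u =>
    (abs_add_le _ _).trans (add_le_add le_rfl ((abs_sub _ _).trans (add_le_add (hΨ₂ _) (hΨ₂ _))))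
  refine divFree_current_S0NAt_of_sectors hr cE cVH cΛ ν β hh hs v ?_ ?_
  · exact hW ν β c₁ Ψ₁ B₁ hΨ₁ c₂ Ψ₂ B₂ hΨ₂ v
  · exact divFree_lamSectorZero_current hr ν β c₂ Ψ₂ hΨ₂ _ v

/-- [folklore] **THE (D)-TOWER ON THE SPINE**: from the bare Wilson hypothesis, every member `SrecAt j` has first-leg divergence-free class-weighted two-leg currents. -/
theorem divFree_SrecAt_all_of_wilson (hr : r ∈ box (d + 1) Lc) (cE cVH cΛ : ℝ)
    (hW : ∀ (ν β : Fin (d + 1)) (c₁ : ℝ) (Ψ₁ : ℤ → ℝ) (B₁ : ℝ), (∀ s, |Ψ₁ s| ≤ B₁) → ∀ (c₂ : ℝ) (Ψ₂ : ℤ → ℝ) (B₂ : ℝ), (∀ s, |Ψ₂ s| ≤ B₂) → ∀ v : Site (d + 1),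
      ∑ κ' : Fin (d + 1),
        ((∑' q : Site (d + 1), (c₁ + (Ψ₁ (q β + 1) - Ψ₁ (q β))) * ∑' u : Site (d + 1), (c₂ + (Ψ₂ (u ν + 1) - Ψ₂ (u ν))) * wilsonA d ν u v q (Sum.inl κ') (Sum.inl β))
          - ∑' q : Site (d + 1), (c₁ + (Ψ₁ (q β + 1) - Ψ₁ (q β))) * ∑' u : Site (d + 1), (c₂ + (Ψ₂ (u ν + 1) - Ψ₂ (u ν))) * wilsonA d ν u (v - unitVec κ') q (Sum.inl κ') (Sum.inl β)) = 0)
    (j : ℕ) :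
    ∀ (ν β : Fin (d + 1)) (c₁ : ℝ) (Ψ₁ : ℤ → ℝ) (B₁ : ℝ), (∀ s, |Ψ₁ s| ≤ B₁) → ∀ (c₂ : ℝ) (Ψ₂ : ℤ → ℝ) (B₂ : ℝ), (∀ s, |Ψ₂ s| ≤ B₂) → ∀ v : Site (d + 1),
      ∑ κ' : Fin (d + 1),
        ((∑' q : Site (d + 1), (c₁ + (Ψ₁ (q β + 1) - Ψ₁ (q β))) * ∑' u : Site (d + 1), (c₂ + (Ψ₂ (u ν + 1) - Ψ₂ (u ν))) *
            SrecAt d Lc (toSite r) cE cVH cΛ j ν u v q (Sum.inl κ') (Sum.inl β))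
          - ∑' q : Site (d + 1), (c₁ + (Ψ₁ (q β + 1) - Ψ₁ (q β))) * ∑' u : Site (d + 1), (c₂ + (Ψ₂ (u ν + 1) - Ψ₂ (u ν))) *
            SrecAt d Lc (toSite r) cE cVH cΛ j ν u (v - unitVec κ') q (Sum.inl κ') (Sum.inl β)) = 0 := by
  induction j with
  | zero =>
    simpa only [SrecAt_zero] using divFree_S0NAt_of_wilson hr cE cVH cΛ hW
  | succ j ih =>
    exact divFree_SrecAt_succ_of_divFree hr cE cVH cΛ j ih

/-- [folklore] **… AND OF THE CUBIC SECTOR OF EVERY MEMBER** (`e3OfK Lc G_j (SrecAt j)` — the E-sector of member `j+1` without its scalar, the shape E's `(hdiv)` consumes). -/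
theorem divFree_e3OfK_SrecAt_of_wilson (hr : r ∈ box (d + 1) Lc) (cE cVH cΛ : ℝ)
    (hW : ∀ (ν β : Fin (d + 1)) (c₁ : ℝ) (Ψ₁ : ℤ → ℝ) (B₁ : ℝ), (∀ s, |Ψ₁ s| ≤ B₁) → ∀ (c₂ : ℝ) (Ψ₂ : ℤ → ℝ) (B₂ : ℝ), (∀ s, |Ψ₂ s| ≤ B₂) → ∀ v : Site (d + 1),
      ∑ κ' : Fin (d + 1),
        ((∑' q : Site (d + 1), (c₁ + (Ψ₁ (q β + 1) - Ψ₁ (q β))) * ∑' u : Site (d + 1), (c₂ + (Ψ₂ (u ν + 1) - Ψ₂ (u ν))) * wilsonA d ν u v q (Sum.inl κ') (Sum.inl β))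
          - ∑' q : Site (d + 1), (c₁ + (Ψ₁ (q β + 1) - Ψ₁ (q β))) * ∑' u : Site (d + 1), (c₂ + (Ψ₂ (u ν + 1) - Ψ₂ (u ν))) * wilsonA d ν u (v - unitVec κ') q (Sum.inl κ') (Sum.inl β)) = 0)
    (j : ℕ) (ν β : Fin (d + 1)) (c : ℝ) (Φ : ℤ → ℝ) {B : ℝ} (hΦ : ∀ s, |Φ s| ≤ B) (c' : ℝ) (Φ' : ℤ → ℝ) {B' : ℝ} (hΦ' : ∀ s, |Φ' s| ≤ B') (y : Site (d + 1)) :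
    ∑ μ : Fin (d + 1),
      ((∑' w : Site (d + 1), (c + (Φ (w β + 1) - Φ (w β))) * ∑' t : Site (d + 1), (c' + (Φ' (t ν + 1) - Φ' (t ν))) *
          e3OfK Lc (coDressKBmAt (toSite r) Lc (KInvStep (d := d) Lc j)) (SrecAt d Lc (toSite r) cE cVH cΛ j) ν t y w (Sum.inl μ) (Sum.inl β))
        - ∑' w : Site (d + 1), (c + (Φ (w β + 1) - Φ (w β))) * ∑' t : Site (d + 1), (c' + (Φ' (t ν + 1) - Φ' (t ν))) *
          e3OfK Lc (coDressKBmAt (toSite r) Lc (KInvStep (d := d) Lc j)) (SrecAt d Lc (toSite r) cE cVH cΛ j) ν t (y - unitVec μ) w (Sum.inl μ) (Sum.inl β)) = 0 := by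
  have hLc : 1 ≤ Lc := Nat.one_le_iff_ne_zero.mpr (NeZero.ne Lc)
  obtain ⟨Cs, δs, hδs, hS⟩ := locStencil_SrecAt hLc hr cE cVH cΛ j
  have hpar := trK_SrecAt (d := d) hLc hr cE cVH cΛ j
  exact divFree_e3OfK_of_divFree hr j hS hδs hpar ν β ((divFree_SrecAt_all_of_wilson hr cE cVH cΛ hW j) ν β) c Φ hΦ c' Φ' hΦ' y

/-- [folklore] **THE (D)-TOWER, UNCONDITIONAL ON THE SPINE**: every member `SrecAt j` has first-leg divergence-free class-weighted two-leg currents (T0 via `WilsonCurrentBoxForm`). -/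
theorem divFree_SrecAt_all (hr : r ∈ box (d + 1) Lc) (cE cVH cΛ : ℝ) (j : ℕ) (ν β : Fin (d + 1))
    (c₁ : ℝ) (Ψ₁ : ℤ → ℝ) {B₁ : ℝ} (hΨ₁ : ∀ s, |Ψ₁ s| ≤ B₁) (c₂ : ℝ) (Ψ₂ : ℤ → ℝ) {B₂ : ℝ} (hΨ₂ : ∀ s, |Ψ₂ s| ≤ B₂) (v : Site (d + 1)) :
    ∑ κ' : Fin (d + 1),
      ((∑' q : Site (d + 1), (c₁ + (Ψ₁ (q β + 1) - Ψ₁ (q β))) * ∑' u : Site (d + 1), (c₂ + (Ψ₂ (u ν + 1) - Ψ₂ (u ν))) *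
          SrecAt d Lc (toSite r) cE cVH cΛ j ν u v q (Sum.inl κ') (Sum.inl β))
        - ∑' q : Site (d + 1), (c₁ + (Ψ₁ (q β + 1) - Ψ₁ (q β))) * ∑' u : Site (d + 1), (c₂ + (Ψ₂ (u ν + 1) - Ψ₂ (u ν))) *
          SrecAt d Lc (toSite r) cE cVH cΛ j ν u (v - unitVec κ') q (Sum.inl κ') (Sum.inl β)) = 0 :=
  divFree_SrecAt_all_of_wilson hr cE cVH cΛ
    (fun ν β c₁ Ψ₁ _ _ c₂ Ψ₂ _ _ v => divFree_wilson_current ν β (fun n => c₁ + (Ψ₁ (n + 1) - Ψ₁ n)) (fun n => c₂ + (Ψ₂ (n + 1) - Ψ₂ n)) v)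
    j ν β c₁ Ψ₁ B₁ hΨ₁ c₂ Ψ₂ B₂ hΨ₂ v

/-- [folklore] **THE (D)-TOWER, UNCONDITIONAL — THE CUBIC SECTOR OF EVERY MEMBER**: for every `j`, every in-block root, all `cE cVH cΛ`, all class data and every `y`,
`Σ_μ (J(μ,y) − J(μ,y−e_μ)) = 0` for `J(μ,y) = Σ'_w (c + dΦ(w_β))·Σ'_t (c′ + dΦ′(t_ν))·e3OfK Lc G_j (SrecAt j) ν t y w (inl μ)(inl β)`. -/
theorem divFree_e3OfK_SrecAt (hr : r ∈ box (d + 1) Lc) (cE cVH cΛ : ℝ) (j : ℕ) (ν β : Fin (d + 1))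
    (c : ℝ) (Φ : ℤ → ℝ) {B : ℝ} (hΦ : ∀ s, |Φ s| ≤ B) (c' : ℝ) (Φ' : ℤ → ℝ) {B' : ℝ} (hΦ' : ∀ s, |Φ' s| ≤ B') (y : Site (d + 1)) :
    ∑ μ : Fin (d + 1),
      ((∑' w : Site (d + 1), (c + (Φ (w β + 1) - Φ (w β))) * ∑' t : Site (d + 1), (c' + (Φ' (t ν + 1) - Φ' (t ν))) *
          e3OfK Lc (coDressKBmAt (toSite r) Lc (KInvStep (d := d) Lc j)) (SrecAt d Lc (toSite r) cE cVH cΛ j) ν t y w (Sum.inl μ) (Sum.inl β))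
        - ∑' w : Site (d + 1), (c + (Φ (w β + 1) - Φ (w β))) * ∑' t : Site (d + 1), (c' + (Φ' (t ν + 1) - Φ' (t ν))) *
          e3OfK Lc (coDressKBmAt (toSite r) Lc (KInvStep (d := d) Lc j)) (SrecAt d Lc (toSite r) cE cVH cΛ j) ν t (y - unitVec μ) w (Sum.inl μ) (Sum.inl β)) = 0 :=
  divFree_e3OfK_SrecAt_of_wilson hr cE cVH cΛ
    (fun ν β c₁ Ψ₁ _ _ c₂ Ψ₂ _ _ v => divFree_wilson_current ν β (fun n => c₁ + (Ψ₁ (n + 1) - Ψ₁ n)) (fun n => c₂ + (Ψ₂ (n + 1) - Ψ₂ n)) v)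
    j ν β c Φ hΦ c' Φ' hΦ' y

end Summit.QuantumFields.BalabanUV.Beta.GAN24.ExitFaceCurrentTower

end

/-!
# Part B — namespace `…GAN24.ExitFaceCurrentDivFree`: THE CONSUMER BRIDGE (R3, second half; E's `(hdiv)`)
-/

noncomputable section

open Finset
open scoped BigOperators
open Literature.MathematicalPhysics.QuantumFieldTheory
open Literature.MathematicalPhysics.QuantumFieldTheory.Balaban1983to89
open Literature.MathematicalPhysics.QuantumFieldTheory.Balaban1983to89.Beta
open ExpKernelCalculus (Site MKer)
open OneStepResolventKernel (Fib LocStencil)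
open OneStepKernelFamily (KInvStep vertexOfK)
open AffineAveraging (box toSite)
open StepJetData (locStencil_smul)
open Summit.QuantumFields.BalabanUV.Beta.AxialDressingRooted (coDressKBmAt decays_coDressKBmAt_KInvStep)
open Summit.QuantumFields.BalabanUV.Beta.HessKerDressedUnits (unitK unitS unitS_apply locStencil_unitS legScale_inl)
open Summit.QuantumFields.BalabanUV.Beta.SpineRooted (e3OfK locStencil_e3OfK)
open Summit.QuantumFields.BalabanUV.Beta.WardLocusRecursive (SrecAt locStencil_SrecAt)
open Summit.QuantumFields.BalabanUV.Beta.GAN24.ExitFaceCurrentCellTotals (tsum_weight_current_eq_faceSlot)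
open Summit.QuantumFields.BalabanUV.Beta.GAN24.ExitFaceCurrentTower (divFree_e3OfK_SrecAt)
open Summit.QuantumFields.BalabanUV.Beta.GAN24.FaceDatumMultiplierResponse (sawtooth_step)

namespace Summit.QuantumFields.BalabanUV.Beta.GAN24.ExitFaceCurrentDivFree

variable {d : ℕ} {Lc : ℕ} [NeZero Lc] {r : Fin (d + 1) → ℕ}

/-- [folklore] **THE FACE INDICATOR IS A CLASS DATUM**: `𝟙[n mod Lc = Lc−1] = Lc⁻¹ + (Φ(n+1) − Φ(n))`, `Φ(n) = −Lc⁻¹·(n mod Lc)`. -/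
theorem face_eq_class (n : ℤ) :
    (Lc : ℝ)⁻¹ + ((-((Lc : ℝ)⁻¹) * ((((n + 1) % (Lc : ℤ) : ℤ) : ℝ))) - (-((Lc : ℝ)⁻¹) * (((n % (Lc : ℤ) : ℤ) : ℝ)))) =
      if n % (Lc : ℤ) = (Lc : ℤ) - 1 then (1 : ℝ) else 0 := by
  have hLc : 1 ≤ Lc := Nat.one_le_iff_ne_zero.mpr (NeZero.ne Lc)
  have hL0 : (Lc : ℝ) ≠ 0 := by exact_mod_cast NeZero.ne Lc
  have hs := sawtooth_step (Lc := Lc) hLc n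
  have e : (Lc : ℝ)⁻¹ + ((-((Lc : ℝ)⁻¹) * ((((n + 1) % (Lc : ℤ) : ℤ) : ℝ))) - (-((Lc : ℝ)⁻¹) * (((n % (Lc : ℤ) : ℤ) : ℝ)))) =
      (Lc : ℝ)⁻¹ * (1 - (((((n + 1) % (Lc : ℤ) : ℤ) : ℝ)) - (((n % (Lc : ℤ) : ℤ) : ℝ)))) := by ring
  rw [e, hs]
  field_simp
  ring

/-- [folklore] The primitive is bounded: `|−Lc⁻¹·(n mod Lc)| ≤ 1`. -/
theorem abs_facePot_le (n : ℤ) : |-((Lc : ℝ)⁻¹) * (((n % (Lc : ℤ) : ℤ) : ℝ))| ≤ 1 := by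
  have hLc : 1 ≤ Lc := Nat.one_le_iff_ne_zero.mpr (NeZero.ne Lc)
  have hL : (0 : ℤ) < Lc := by exact_mod_cast hLc
  have hLr : (0 : ℝ) < Lc := by exact_mod_cast hL
  have hm0 : (0 : ℝ) ≤ (((n % (Lc : ℤ) : ℤ) : ℝ)) := by exact_mod_cast Int.emod_nonneg _ hL.ne'
  have hm1 : (((n % (Lc : ℤ) : ℤ) : ℝ)) ≤ (Lc : ℝ) := by exact_mod_cast (Int.emod_lt_of_pos n hL).le
  rw [abs_mul, abs_neg, abs_inv, abs_of_pos hLr, abs_of_nonneg hm0]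
  calc (Lc : ℝ)⁻¹ * (((n % (Lc : ℤ) : ℤ) : ℝ)) ≤ (Lc : ℝ)⁻¹ * (Lc : ℝ) := mul_le_mul_of_nonneg_left hm1 (by positivity)
    _ = 1 := by field_simp

omit [NeZero Lc] in
/-- [folklore] Units and a scalar on an ff entry of a table family are a constant factor: `unitS sf sm (C₀ • S) κ t x z (inl a)(inl b) = ((sf·sm)⁻¹·sf⁻¹·sf⁻¹·C₀)·S κ t x z (inl a)(inl b)`. -/
theorem unitS_smul_inl_inl (sf sm C₀ : ℝ) (S : Fin (d + 1) → Site (d + 1) → MKer (d + 1) (Fib d)) (κ : Fin (d + 1)) (t x z : Site (d + 1)) (a b : Fin (d + 1)) :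
    unitS sf sm (fun κ' t' => C₀ • S κ' t') κ t x z (Sum.inl a) (Sum.inl b) = ((sf * sm)⁻¹ * (sf⁻¹ * sf⁻¹ * C₀)) * S κ t x z (Sum.inl a) (Sum.inl b) := by
  rw [unitS_apply, legScale_inl, legScale_inl]
  simp only [Pi.smul_apply, smul_eq_mul]
  ring

/-- [folklore] **(D)_{j+1} — E's `(hdiv)`, UNCONDITIONALLY**: the bond-resummed exit-face pair current through the dressed half vertex of the rescaled, unit-changed cubic table
`unitS sf sm (C₀ • e3OfK Lc G_j (SrecAt j))` is divergence-free at every site `p`, for every `j`, every in-block root, all `sf sm cE cVH cΛ C₀`, every slot direction `ν` and face direction `β`. -/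
theorem exitFace_pairCurrent_divFree (hr : r ∈ box (d + 1) Lc) (sf sm cE cVH cΛ C₀ : ℝ) (j : ℕ) (ν β : Fin (d + 1)) (p : Site (d + 1)) :
    ∑ b : Fin (d + 1),
      ((∑' uw : Site (d + 1) × Site (d + 1), (if uw.2 β % (Lc : ℤ) = (Lc : ℤ) - 1 then (1 : ℝ) else 0) *
        vertexOfK (unitK sf sm (coDressKBmAt (toSite r) Lc (KInvStep (d := d) Lc (j + 1)))) Lc
          (unitS sf sm (fun κ t => C₀ • e3OfK Lc (coDressKBmAt (toSite r) Lc (KInvStep (d := d) Lc j)) (SrecAt d Lc (toSite r) cE cVH cΛ j) κ t)) ν uw.1 p uw.2 (Sum.inl b) (Sum.inl β)) -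
       (∑' uw : Site (d + 1) × Site (d + 1), (if uw.2 β % (Lc : ℤ) = (Lc : ℤ) - 1 then (1 : ℝ) else 0) *
        vertexOfK (unitK sf sm (coDressKBmAt (toSite r) Lc (KInvStep (d := d) Lc (j + 1)))) Lc
          (unitS sf sm (fun κ t => C₀ • e3OfK Lc (coDressKBmAt (toSite r) Lc (KInvStep (d := d) Lc j)) (SrecAt d Lc (toSite r) cE cVH cΛ j) κ t)) ν uw.1 (p - AffineAveraging.unitVec b) uw.2
          (Sum.inl b) (Sum.inl β))) = 0 := by
  classical
  have hLc : 1 ≤ Lc := Nat.one_le_iff_ne_zero.mpr (NeZero.ne Lc)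
  -- the rescaled, unit-changed cubic table is a local stencil family
  obtain ⟨Cs, δs, hδs, hS⟩ := locStencil_SrecAt hLc hr cE cVH cΛ j
  obtain ⟨C₁, δ₁, hδ₁, h1⟩ := locStencil_e3OfK (N := Lc) hLc (decays_coDressKBmAt_KInvStep (d := d) hr j) hS hδs
  have hSE := locStencil_smul C₀ h1
  have hSu := locStencil_unitS (sf := sf) (sm := sm) hSE
  have hρ : ∀ w : Site (d + 1), |(if w β % (Lc : ℤ) = (Lc : ℤ) - 1 then (1 : ℝ) else 0)| ≤ 1 := fun w => by split_ifs <;> simp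
  -- the pair current as the face-slot ∕ face-leg current of the bare cubic table, times a constant
  have ecur : ∀ (b : Fin (d + 1)) (z : Site (d + 1)),
      ∑' uw : Site (d + 1) × Site (d + 1), (if uw.2 β % (Lc : ℤ) = (Lc : ℤ) - 1 then (1 : ℝ) else 0) *
        vertexOfK (unitK sf sm (coDressKBmAt (toSite r) Lc (KInvStep (d := d) Lc (j + 1)))) Lc
          (unitS sf sm (fun κ t => C₀ • e3OfK Lc (coDressKBmAt (toSite r) Lc (KInvStep (d := d) Lc j)) (SrecAt d Lc (toSite r) cE cVH cΛ j) κ t)) ν uw.1 z uw.2 (Sum.inl b) (Sum.inl β) =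
      ((((Lc : ℝ) * (sm * sf)) * ((((Lc ^ (j + 1 + 1) : ℕ) : ℝ)) ^ (d + 1 + 1))⁻¹) * ((sf * sm)⁻¹ * (sf⁻¹ * sf⁻¹ * C₀))) *
        ∑' w : Site (d + 1), (if w β % (Lc : ℤ) = (Lc : ℤ) - 1 then (1 : ℝ) else 0) *
          ∑' t : Site (d + 1), (if t ν % (Lc : ℤ) = (Lc : ℤ) - 1 then (1 : ℝ) else 0) *
            e3OfK Lc (coDressKBmAt (toSite r) Lc (KInvStep (d := d) Lc j)) (SrecAt d Lc (toSite r) cE cVH cΛ j) ν t z w (Sum.inl b) (Sum.inl β) := by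
    intro b z
    have hX : ∑' w : Site (d + 1), (if w β % (Lc : ℤ) = (Lc : ℤ) - 1 then (1 : ℝ) else 0) *
        ∑' t : Site (d + 1), (if t ν % (Lc : ℤ) = (Lc : ℤ) - 1 then
          unitS sf sm (fun κ t => C₀ • e3OfK Lc (coDressKBmAt (toSite r) Lc (KInvStep (d := d) Lc j)) (SrecAt d Lc (toSite r) cE cVH cΛ j) κ t) ν t z w (Sum.inl b) (Sum.inl β) else 0) =
        ((sf * sm)⁻¹ * (sf⁻¹ * sf⁻¹ * C₀)) * ∑' w : Site (d + 1), (if w β % (Lc : ℤ) = (Lc : ℤ) - 1 then (1 : ℝ) else 0) *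
          ∑' t : Site (d + 1), (if t ν % (Lc : ℤ) = (Lc : ℤ) - 1 then (1 : ℝ) else 0) *
            e3OfK Lc (coDressKBmAt (toSite r) Lc (KInvStep (d := d) Lc j)) (SrecAt d Lc (toSite r) cE cVH cΛ j) ν t z w (Sum.inl b) (Sum.inl β) := by
      have hin : ∀ w : Site (d + 1), (∑' t : Site (d + 1), (if t ν % (Lc : ℤ) = (Lc : ℤ) - 1 then
          unitS sf sm (fun κ t => C₀ • e3OfK Lc (coDressKBmAt (toSite r) Lc (KInvStep (d := d) Lc j)) (SrecAt d Lc (toSite r) cE cVH cΛ j) κ t) ν t z w (Sum.inl b) (Sum.inl β) else 0)) =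
          ((sf * sm)⁻¹ * (sf⁻¹ * sf⁻¹ * C₀)) * ∑' t : Site (d + 1), (if t ν % (Lc : ℤ) = (Lc : ℤ) - 1 then (1 : ℝ) else 0) *
            e3OfK Lc (coDressKBmAt (toSite r) Lc (KInvStep (d := d) Lc j)) (SrecAt d Lc (toSite r) cE cVH cΛ j) ν t z w (Sum.inl b) (Sum.inl β) := by
        intro w
        rw [← tsum_mul_left]
        refine tsum_congr fun t => ?_
        by_cases ht : t ν % (Lc : ℤ) = (Lc : ℤ) - 1
        · rw [if_pos ht, if_pos ht, unitS_smul_inl_inl, one_mul]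
        · rw [if_neg ht, if_neg ht, zero_mul, mul_zero]
      simp only [hin]
      rw [← tsum_mul_left]
      exact tsum_congr fun w => by ring
    rw [tsum_weight_current_eq_faceSlot hLc hr sf sm (j + 1) hSu hδ₁ hρ ν z (Sum.inl b) (Sum.inl β), hX]
    ring
  -- the tower, with the face indicator as the class datum on both the slot and the leg
  set Φ : ℤ → ℝ := fun n => -((Lc : ℝ)⁻¹) * (((n % (Lc : ℤ) : ℤ) : ℝ)) with hΦ
  have hΦb : ∀ s, |Φ s| ≤ 1 := fun s => abs_facePot_le (Lc := Lc) s
  have key := divFree_e3OfK_SrecAt (d := d) hr cE cVH cΛ j ν β ((Lc : ℝ)⁻¹) Φ hΦb ((Lc : ℝ)⁻¹) Φ hΦb p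
  have eface : ∀ n : ℤ, (Lc : ℝ)⁻¹ + (Φ (n + 1) - Φ n) = if n % (Lc : ℤ) = (Lc : ℤ) - 1 then (1 : ℝ) else 0 := fun n => by
    simp only [hΦ]; exact face_eq_class (Lc := Lc) n
  have hUV : ∀ b : Fin (d + 1), (B6BondElimination.unitVec b : Site (d + 1)) = AffineAveraging.unitVec b := fun b =>
    funext fun l => by simp [B6BondElimination.unitVec_apply, AffineAveraging.unitVec_apply]
  simp only [eface, hUV] at key
  simp only [ecur, ← mul_sub, ← Finset.mul_sum, key, mul_zero]

end Summit.QuantumFields.BalabanUV.Beta.GAN24.ExitFaceCurrentDivFree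

end
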